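import Summits.QuantumFields.YangMills.Theorems.BalabanUVNodesN07SymPhiCellNumericsOfFineLetter
import Literature.MathematicalPhysics.QuantumFieldTheory.Balaban1983to89.B7Prop2Rec
import Literature.MathematicalPhysics.QuantumFieldTheory.Balaban1983to89.B7Prop2Explicit
import Literature.MathematicalPhysics.QuantumFieldTheory.Balaban1983to89.Node00.TorusCoverCubeMemberPrint
import HarnessLib

/-!
# N07 [B11] (= [15] = [Balaban1985Variational]) Sect. F ∕ [I] (0.4), (0.11) — MODULE 139b (ASK-7, second half): **THE JUNCTION's DISPLAYED NUMERICS `hnum` OF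
# dag-n07-w3's INTENT-35 `…N07JunctionHJ.hJ_holds` (19 rows per datum, HOME `pub-ymgap-dag-n07-w3/HNUM-TABLE-INTENT35.txt`, VERBATIM) FROM ONE SMALLNESS LIST ON THE RUN's
# LETTER `a₀` AND THE JUNCTION's TWO CHOICES `κ`, `ψc`** — so that the per-datum row-9′ supplier `hJ` is numerics-free modulo eight monomial conditions on `a₀`

Cell `pub-ymgap`, seat `pub-ymgap-dag-n07-e` g33 (FAN-OUT §N07 row s3; LANE OWNER of the K0 road chart side; ASK-7 of director-ym №330).  `--kind proof --supports
stmt-QuantumFields-20541 --as helper` (K0⁷; count-neutral).  ONE theorem, 0 `def`; the record family `F.P K` (`d = 4`, `L = F.L > 11`).  [I] = [Balaban1987RG1];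
[15] = [Balaban1985Variational]; [6] = [Balaban1985RegularSpaces]; [3] = [Balaban1985Averaging].  Elementary real arithmetic; `deltaSU (Fin N)`, `(FederbushMean.federbushSU).δ`,
`C0Z`, `c2'`, `Real.pi` enter only as right-hand sides of displayed conditions.

WHY.  The junction's closing file takes the 19-row conjunction `hnum` (per datum `(K, k, j, ε)`: ✓p758613's four rows at the fine letter `a₀′ := ε_{j−1}·η_{j−1}²`, MODULE 138's three
two-block rows, INTENT-33's three Prop-1∕(1.130) rows at `α₀ := L³ε_{j−1}`, the cell lemma's `ω_τ ≤ 1∕128`, `4ω_τ < δ_N`, `ω_τ + ω_u ≤ 1∕512`, `4096L⁻¹(ω_τ+ω_u) ≤ 1`, the guard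
`4(ω_τ+ω_u) + 32768(ω_τ+ω_u)² < δ_N`, the crown's `18ω_τ ≤ ω₁`, the door budget `2rL⁴ < κε_j`, `4Nr < 2π`, and row 9′'s size `1024(4(ω_τ+ω_u))² ≤ Ψ ε j`) as a DISPLAYED hypothesis.
At the record (`d = 4`, `η_n = L^{−n}`) every left-hand side is a monomial: `L^{2j+2}·ε_{j−1}η_{j−1}² = L⁴ε_{j−1}` (so `Ω₀ = 216L⁴ε_{j−1}`, `Ω₁ = 108L⁴ε_{j−1}`, `Ω₂ = 2592L⁵ε_{j−1}`,
`ω_τ = 829440L⁴ε_{j−1}`), `s = ⌊(L−1)∕2⌋ ≤ L∕2` gives `ω_τ + ω_u ≤ (830352 + 4Cr + 59719680Cω)·L⁵·ε_{j−1}` and `r ≤ (Cr + 14929920Cω)·L⁴·ε_{j−1}`, and `ε_{j−1} ≤ a₀`, `ε_{j−1} ≤ 2ε_j`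
turn the nineteen rows into EIGHT conditions on `a₀` (the others are implied: `C0Z 4 = 26419200`, `h11 ⇒ n1, n3`, `h12 ⇒ n4`, `h13∕h15 ⇒ n7, n8, n10`) plus the two choices `κ > 4(Cr + 14929920Cω)L⁸`, `ψc·κ² ≥ 65536·((830352 + 4Cr + 59719680Cω)L⁵)²` (row 19 at
`Ψ ε j := ψc·(κ·ε_j)²`, MODULE 134′'s shape).  MODULE 139 ✓p763029 supplies the two-block monomials (`twoBlock_bud_le ∕ _gd_le ∕ _sm_le`) and `L⁻¹ ≤ 1∕8`.  NO estimate of [I]∕[15]∕[6]∕[3].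

WHAT IS PROVED (sorry-free; axioms standard).  §2 (v1.1) ★ `exists_fineLetter_small` (some `a₀ > 0` meets the eight rows and the crown's `L³a₀ ≤ α₁`); §3 (v1.1) ★ `exists_kappa_choice` (at the crown's `Cr = 560L³B₀·sideP(ρ₀L)`, `Cω = 20LB₀`: a `κ` above `hnum_of_smallness`'s bound with MODULE 134′'s `κ ≤ Aκ·ρ₀`, `Aκ` uniform in `ρ₀`).  ★★★ `hnum_of_smallness` — the `hnum` hypothesis of `hJ_holds` VERBATIM (`Ψ ε j := ψc·(κ·ε j)²`), from `0 ≤ Cr`, `0 ≤ Cω`, `0 < a₀`, the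
eight conditions and the two choices.
HONEST FRAMING: count-neutral helper; elementary arithmetic — nothing of [I]∕[15]∕[6]∕[3] asserted or discharged; `a₀`, `Cr`, `Cω`, `ω₁`, `κ`, `ψc` and the eight conditions remain
DISPLAYED (the junction ∕ the chart's `hsup` choose them per `ρ₀`); `hJ` ∕ `DatumCrownPhiAt` ∕ `hsup` ∕ HSEAM inhabited by nobody; `HThm4RecSym152PhiEG` ∕ `HThm4Rec*` UNDISCHARGED;
N05 ∕ N07 NOT discharged; K0⁷ ∕ K1⁹ NOT closed; counts unmoved (typed 28∕28 · discharged 8∕28); R4 closes the conditional finite-𝕋⁴ rung `BalabanLadder.UV` only; the YM mass gap (Clay)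
is NOT proved by any of this; nothing continuum ∕ ℝ⁴ ∕ OS.  No `def`, no `instance`, no `notation`, no `sorry`.

References: [I] (0.4) p. 253, (0.11) p. 253, p. 251 («L > 11»); [15] (147)–(154) pp. 301–302; [6] (1.15) p. 78, Lemma 1 p. 79, (1.130) p. 99; [3] (78)–(81) p. 30, Prop. 1 p. 25.
-/

set_option autoImplicit false

noncomputable section

namespace Summit.QuantumFields.YangMills.BalabanUVNodes.N07JunctionHnumOfSmallness

open Literature.MathematicalPhysics.QuantumFieldTheory.Balaban1983to89
open ExpMeanLog (deltaSU)
open B7Prop2Rec (C0Z)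
open B7Prop2Explicit (c2')
open T4Continuum (T4Family)
open Literature.MathematicalPhysics.QuantumFieldTheory.Balaban1983to89.Node00 (sideP sideP_le)
open Summit.QuantumFields.YangMills.BalabanUVNodes.N07SymPhiCellNumericsOfFineLetter (twoBlock_bud_le twoBlock_gd_le twoBlock_sm_le inv_L_le_eighth eight_le_L_record)

set_option maxHeartbeats 800000 in
/-- ★★★ **THE JUNCTION's `hnum` FROM ONE SMALLNESS LIST** — see the module docstring: for the record family `F`, constants `Cr, Cω ≥ 0`, the crown's `ω₁`, the run's letter `a₀ > 0`, and
the junction's choices `κ`, `ψc`, the eight monomial conditions on `a₀` (at `L := F.L`: `480·216L⁴a₀ < δ_Fed`, `2L⁵a₀ ≤ c2' 4 L`, `3840·216L⁴a₀ ≤ 1∕128`, `4·3840·216L⁴a₀ < δ_N`, `18·3840·216L⁴a₀ ≤ ω₁`, `(830352 + 4Cr + 59719680Cω)L⁵a₀ ≤ 1∕512`, `68·(…)L⁵a₀ < δ_N`, `4N(Cr + 14929920Cω)L⁴a₀ < 2π`) and the two choices `4(Cr + 14929920Cω)L⁸ < κ`, `65536·((830352 + 4Cr + 59719680Cω)L⁵)²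 ≤ ψc·κ²`
give, for every datum `(K, k, j, ε)` of the run (`1 ≤ j ≤ k`, `0 < ε_n ≤ a₀`, `ε_n ≤ 2ε_{n+1}`), the 19-row conjunction `hnum` of dag-n07-w3's `hJ_holds` VERBATIM with `Ψ ε j := ψc·(κ·ε j)²`.
[cite: Balaban1987RG1, (0.4) p.253, (0.11) p.253; Balaban1985Variational, (147)–(154) pp.301–302; Balaban1985RegularSpaces, (1.15) p.78, (1.130) p.99; Balaban1985Averaging, (78)–(81) p.30] -/
theorem hnum_of_smallness (F : T4Family) (N : ℕ) [NeZero N] {Cr Cω ω₁ κ ψc a₀ : ℝ} (hCr : 0 ≤ Cr) (hCω : 0 ≤ Cω)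
    (h2 : 480 * (216 * (F.L : ℝ) ^ 4 * a₀) < (FederbushMean.federbushSU (n := Fin N)).δ)
    (h9 : 2 * ((F.L : ℝ) ^ 5 * a₀) ≤ c2' 4 F.L)
    (h11 : 3840 * (216 * (F.L : ℝ) ^ 4 * a₀) ≤ 1 / 128)
    (h12 : 4 * (3840 * (216 * (F.L : ℝ) ^ 4 * a₀)) < deltaSU (Fin N))
    (h16 : 18 * (3840 * (216 * (F.L : ℝ) ^ 4 * a₀)) ≤ ω₁)
    (h13 : (830352 + 4 * Cr + 59719680 * Cω) * (F.L : ℝ) ^ 5 * a₀ ≤ 1 / 512)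
    (h15 : 68 * ((830352 + 4 * Cr + 59719680 * Cω) * (F.L : ℝ) ^ 5 * a₀) < deltaSU (Fin N))
    (h18 : 4 * ((N : ℝ) * ((Cr + 14929920 * Cω) * (F.L : ℝ) ^ 4 * a₀)) < 2 * Real.pi)
    (hκ : 4 * (Cr + 14929920 * Cω) * (F.L : ℝ) ^ 8 < κ)
    (hψ : 65536 * ((830352 + 4 * Cr + 59719680 * Cω) * (F.L : ℝ) ^ 5) ^ 2 ≤ ψc * κ ^ 2) :
    ∀ (K k j : ℕ) (ε : ℕ → ℝ), 1 ≤ j → j ≤ k → (∀ n, n ≤ k → 0 < ε n ∧ ε n ≤ a₀) → (∀ n, n < k → ε n ≤ 2 * ε (n + 1)) →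
      48000 * (((F.P K).d : ℝ) * (((F.P K).d : ℝ) + 2) * (((F.P K).d - 1 : ℕ) : ℝ) ^ 2 * ((F.P K).L : ℝ) ^ (2 * j + 2) * (ε (j - 1) * (F.P K).eta (j - 1) ^ 2)) ≤ 1 ∧
      480 * (((F.P K).d : ℝ) * (((F.P K).d : ℝ) + 2) * (((F.P K).d - 1 : ℕ) : ℝ) ^ 2 * ((F.P K).L : ℝ) ^ (2 * j + 2) * (ε (j - 1) * (F.P K).eta (j - 1) ^ 2)) < (FederbushMean.federbushSU (n := Fin N)).δ ∧
      6400 * ((((F.P K).d : ℝ) + 2) ^ 2 * (((F.P K).d - 1 : ℕ) : ℝ) * ((F.P K).L : ℝ) ^ (2 * j + 2) * (ε (j - 1) * (F.P K).eta (j - 1) ^ 2)) ≤ 1 ∧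
      30 * ((((F.P K).d : ℝ) + 2) ^ 2 * (((F.P K).d - 1 : ℕ) : ℝ) * ((F.P K).L : ℝ) ^ (2 * j + 2) * (ε (j - 1) * (F.P K).eta (j - 1) ^ 2)) < deltaSU (Fin N) ∧
      (∀ i, i < j → 6400 * ((((F.P K).d + 2) * (F.P K).L : ℕ) : ℝ) ^ 2 * ((F.P K).L : ℝ) ^ (i + 1) * (((((F.P K).d - 1 : ℕ) : ℝ)) * (((2 * (F.P K).L ^ (i + 1) - 1 : ℕ) : ℝ)) * (ε (j - 1) * (F.P K).eta (j - 1) ^ 2)) ≤ 1) ∧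
      (∀ i, i < j → 30 * ((((F.P K).d + 2) * (F.P K).L : ℕ) : ℝ) ^ 2 * ((F.P K).L : ℝ) ^ (i + 1) * (((((F.P K).d - 1 : ℕ) : ℝ)) * (((2 * (F.P K).L ^ (i + 1) - 1 : ℕ) : ℝ)) * (ε (j - 1) * (F.P K).eta (j - 1) ^ 2)) < deltaSU (Fin N)) ∧
      (∀ i, i < j → (((((F.P K).d + 2) * (F.P K).L : ℕ) : ℝ) ^ 2 / 4) * ((4 * (((((F.P K).d - 1 : ℕ) : ℝ)) * ((2 * (F.P K).L - 1 : ℕ) : ℝ)) + 1) * (240 * ((((F.P K).d + 2) * (F.P K).L : ℕ) : ℝ) * ((F.P K).L : ℝ) ^ i * (((((F.P K).d - 1 : ℕ) : ℝ)) * (((2 * (F.P K).L ^ (i + 1) - 1 : ℕ) : ℝ)) * (ε (j - 1) * (F.P K).eta (j - 1) ^ 2)))) < deltaSU (Fin N)) ∧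
      C0Z (F.P K).d * ((((F.P K).L : ℝ) ^ 3 * ε (j - 1)) * ((F.P K).L : ℝ) ^ 2) ≤ 1 / 3 ∧
      2 * ((((F.P K).L : ℝ) ^ 3 * ε (j - 1)) * ((F.P K).L : ℝ) ^ 2) ≤ c2' (F.P K).d (F.P K).L ∧
      11 * ((F.P K).d : ℝ) ^ 2 * ((F.P K).L : ℝ) ^ 2 * (((F.P K).L : ℝ) ^ 3 * ε (j - 1)) ≤ 1 / 6 ∧
      (3840 * (((F.P K).d : ℝ) * (((F.P K).d : ℝ) + 2) * (((F.P K).d - 1 : ℕ) : ℝ) ^ 2 * ((F.P K).L : ℝ) ^ (2 * j + 2) * (ε (j - 1) * (F.P K).eta (j - 1) ^ 2))) ≤ 1 / 128 ∧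
      4 * (3840 * (((F.P K).d : ℝ) * (((F.P K).d : ℝ) + 2) * (((F.P K).d - 1 : ℕ) : ℝ) ^ 2 * ((F.P K).L : ℝ) ^ (2 * j + 2) * (ε (j - 1) * (F.P K).eta (j - 1) ^ 2))) < deltaSU (Fin N) ∧
      (3840 * (((F.P K).d : ℝ) * (((F.P K).d : ℝ) + 2) * (((F.P K).d - 1 : ℕ) : ℝ) ^ 2 * ((F.P K).L : ℝ) ^ (2 * j + 2) * (ε (j - 1) * (F.P K).eta (j - 1) ^ 2))) + (3 * ((F.P K).d : ℝ) * ((((F.P K).L - 1) / 2 : ℕ) : ℝ) * ((9 * ((F.P K).d : ℝ) ^ 2 + 4 * ((F.P K).d : ℝ) * ((((F.P K).L - 1) / 2 : ℕ) : ℝ)) * (((F.P K).L : ℝ) ^ 3 * ε (j - 1))) + 2 * ((F.P K).d : ℝ) * ((((F.P K).L - 1) / 2 : ℕ) : ℝ) * (Cr * (((F.P K).L : ℝ) ^ 3 * ε (j - 1)) + Cω * (18 * (3840 * (((F.P K).d : ℝ) * (((F.P K).d : ℝ) + 2) * (((F.P K).d - 1 : ℕ) : ℝ) ^ 2 * ((F.P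 K).L : ℝ) ^ (2 * j + 2) * (ε (j - 1) * (F.P K).eta (j - 1) ^ 2)))))) ≤ 1 / 512 ∧
      4096 * ((F.P K).L : ℝ)⁻¹ * ((3840 * (((F.P K).d : ℝ) * (((F.P K).d : ℝ) + 2) * (((F.P K).d - 1 : ℕ) : ℝ) ^ 2 * ((F.P K).L : ℝ) ^ (2 * j + 2) * (ε (j - 1) * (F.P K).eta (j - 1) ^ 2))) + (3 * ((F.P K).d : ℝ) * ((((F.P K).L - 1) / 2 : ℕ) : ℝ) * ((9 * ((F.P K).d : ℝ) ^ 2 + 4 * ((F.P K).d : ℝ) * ((((F.P K).L - 1) / 2 : ℕ) : ℝ)) * (((F.P K).L : ℝ) ^ 3 * ε (j - 1))) + 2 * ((F.P K).d : ℝ) * ((((F.P K).L - 1) / 2 : ℕ) : ℝ) * (Cr * (((F.P K).L : ℝ) ^ 3 * ε (j - 1)) + Cω * (18 * (3840 * (((F.P K).d : ℝ) * (((F.P K).d : ℝ) + 2) * (((F.P K).d - 1 : ℕ) : ℝ) ^ 2 * ((F.P K).L : ℝ) ^ (2 * j + 2) * (ε (j - 1) * (F.P K).eta (j - 1) ^ 2)))))))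 ≤ 1 ∧
      4 * ((3840 * (((F.P K).d : ℝ) * (((F.P K).d : ℝ) + 2) * (((F.P K).d - 1 : ℕ) : ℝ) ^ 2 * ((F.P K).L : ℝ) ^ (2 * j + 2) * (ε (j - 1) * (F.P K).eta (j - 1) ^ 2))) + (3 * ((F.P K).d : ℝ) * ((((F.P K).L - 1) / 2 : ℕ) : ℝ) * ((9 * ((F.P K).d : ℝ) ^ 2 + 4 * ((F.P K).d : ℝ) * ((((F.P K).L - 1) / 2 : ℕ) : ℝ)) * (((F.P K).L : ℝ) ^ 3 * ε (j - 1))) + 2 * ((F.P K).d : ℝ) * ((((F.P K).L - 1) / 2 : ℕ) : ℝ) * (Cr * (((F.P K).L : ℝ) ^ 3 * ε (j - 1)) + Cω * (18 * (3840 * (((F.P K).d : ℝ) * (((F.P K).d : ℝ) + 2) * (((F.P K).d - 1 : ℕ) : ℝ) ^ 2 * ((F.P K).L : ℝ) ^ (2 * j + 2) * (ε (j - 1) * (F.P K).eta (j - 1) ^ 2))))))) + 32768 * ((3840 * (((F.P K).d : ℝ) * (((F.P K).d : ℝ) + 2) * (((F.P K).d - 1 : ℕ) : ℝ) ^ 2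 * ((F.P K).L : ℝ) ^ (2 * j + 2) * (ε (j - 1) * (F.P K).eta (j - 1) ^ 2))) + (3 * ((F.P K).d : ℝ) * ((((F.P K).L - 1) / 2 : ℕ) : ℝ) * ((9 * ((F.P K).d : ℝ) ^ 2 + 4 * ((F.P K).d : ℝ) * ((((F.P K).L - 1) / 2 : ℕ) : ℝ)) * (((F.P K).L : ℝ) ^ 3 * ε (j - 1))) + 2 * ((F.P K).d : ℝ) * ((((F.P K).L - 1) / 2 : ℕ) : ℝ) * (Cr * (((F.P K).L : ℝ) ^ 3 * ε (j - 1)) + Cω * (18 * (3840 * (((F.P K).d : ℝ) * (((F.P K).d : ℝ) + 2) * (((F.P K).d - 1 : ℕ) : ℝ) ^ 2 * ((F.P K).L : ℝ) ^ (2 * j + 2) * (ε (j - 1) * (F.P K).eta (j - 1) ^ 2))))))) ^ 2 < deltaSU (Fin N) ∧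
      18 * (3840 * (((F.P K).d : ℝ) * (((F.P K).d : ℝ) + 2) * (((F.P K).d - 1 : ℕ) : ℝ) ^ 2 * ((F.P K).L : ℝ) ^ (2 * j + 2) * (ε (j - 1) * (F.P K).eta (j - 1) ^ 2))) ≤ ω₁ ∧
      2 * ((Cr * (((F.P K).L : ℝ) ^ 3 * ε (j - 1)) + Cω * (18 * (3840 * (((F.P K).d : ℝ) * (((F.P K).d : ℝ) + 2) * (((F.P K).d - 1 : ℕ) : ℝ) ^ 2 * ((F.P K).L : ℝ) ^ (2 * j + 2) * (ε (j - 1) * (F.P K).eta (j - 1) ^ 2))))) * ((F.P K).L : ℝ) ^ 4) < κ * ε j ∧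
      4 * ((N : ℝ) * (Cr * (((F.P K).L : ℝ) ^ 3 * ε (j - 1)) + Cω * (18 * (3840 * (((F.P K).d : ℝ) * (((F.P K).d : ℝ) + 2) * (((F.P K).d - 1 : ℕ) : ℝ) ^ 2 * ((F.P K).L : ℝ) ^ (2 * j + 2) * (ε (j - 1) * (F.P K).eta (j - 1) ^ 2)))))) < 2 * Real.pi ∧
      1024 * (4 * ((3840 * (((F.P K).d : ℝ) * (((F.P K).d : ℝ) + 2) * (((F.P K).d - 1 : ℕ) : ℝ) ^ 2 * ((F.P K).L : ℝ) ^ (2 * j + 2) * (ε (j - 1) * (F.P K).eta (j - 1) ^ 2))) + (3 * ((F.P K).d : ℝ) * ((((F.P K).L - 1) / 2 : ℕ) : ℝ) * ((9 * ((F.P K).d : ℝ) ^ 2 + 4 * ((F.P K).d : ℝ) * ((((F.P K).L - 1) / 2 : ℕ) : ℝ)) * (((F.P K).L : ℝ) ^ 3 * ε (j - 1))) + 2 * ((F.P K).d : ℝ) * ((((F.P K).L - 1) / 2 : ℕ) : ℝ) * (Cr * (((F.P K).L : ℝ) ^ 3 * ε (j - 1)) + Cω * (18 * (3840 * (((F.P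 K).d : ℝ) * (((F.P K).d : ℝ) + 2) * (((F.P K).d - 1 : ℕ) : ℝ) ^ 2 * ((F.P K).L : ℝ) ^ (2 * j + 2) * (ε (j - 1) * (F.P K).eta (j - 1) ^ 2)))))))) ^ 2 ≤ ψc * (κ * ε j) ^ 2 := by
  intro K k j ε hj1 hjk hε hcomp
  -- ### the record's letters: `d = 4`, `L = F.L > 11`, `η_{j−1} = L^{−(j−1)}`
  have hdN : (F.P K).d = 4 := T4Family.P_d F K
  have hLN : (F.P K).L = F.L := T4Family.P_L F K
  have hη : (F.P K).eta (j - 1) = ((F.L : ℝ) ^ (j - 1))⁻¹ := by rw [B3GkZeroTorusRescaled.eta_eq_inv_pow, hLN]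
  have hL11 := F.hL11
  have hL1 : (1 : ℝ) ≤ F.L := by exact_mod_cast (show 1 ≤ F.L by omega)
  have hL0 : (0 : ℝ) < F.L := by linarith
  have hd1 : 1 ≤ (F.P K).d := by rw [hdN]; norm_num
  -- ### the datum's letters
  have hE0 : 0 < ε (j - 1) := (hε (j - 1) (by omega)).1
  have hEa : ε (j - 1) ≤ a₀ := (hε (j - 1) (by omega)).2
  have hεj0 : 0 < ε j := (hε j hjk).1
  have hE2 : ε (j - 1) ≤ 2 * ε j := by
    have h := hcomp (j - 1) (by omega)
    rwa [show j - 1 + 1 = j by omega] at h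
  have hEη0 : 0 ≤ ε (j - 1) * (F.P K).eta (j - 1) ^ 2 := by positivity
  -- ### the key identity `L^{2j+2}·(ε_{j−1}η_{j−1}²) = L⁴ε_{j−1}` (and `L^{2j+3}·… = L⁵ε_{j−1}`)
  have key : (F.L : ℝ) ^ (2 * j + 2) * (ε (j - 1) * (((F.L : ℝ) ^ (j - 1))⁻¹) ^ 2) = (F.L : ℝ) ^ 4 * ε (j - 1) := by
    obtain ⟨j', rfl⟩ : ∃ j', j = j' + 1 := ⟨j - 1, by omega⟩
    have hne : (F.L : ℝ) ^ j' ≠ 0 := pow_ne_zero _ hL0.ne'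
    rw [Nat.add_sub_cancel, show 2 * (j' + 1) + 2 = 2 * j' + 4 by ring, pow_add, inv_pow, ← pow_mul, mul_comm j' 2]
    field_simp
  have key3 : (F.L : ℝ) ^ (2 * j + 3) * (ε (j - 1) * (((F.L : ℝ) ^ (j - 1))⁻¹) ^ 2) = (F.L : ℝ) ^ 5 * ε (j - 1) := by
    rw [show 2 * j + 3 = (2 * j + 2) + 1 by ring, pow_succ]
    calc (F.L : ℝ) ^ (2 * j + 2) * (F.L : ℝ) * (ε (j - 1) * (((F.L : ℝ) ^ (j - 1))⁻¹) ^ 2)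
        = (F.L : ℝ) * ((F.L : ℝ) ^ (2 * j + 2) * (ε (j - 1) * (((F.L : ℝ) ^ (j - 1))⁻¹) ^ 2)) := by ring
      _ = (F.L : ℝ) * ((F.L : ℝ) ^ 4 * ε (j - 1)) := by rw [key]
      _ = (F.L : ℝ) ^ 5 * ε (j - 1) := by ring
  -- ### monomial comparisons
  have hY4 : (F.L : ℝ) ^ 4 * ε (j - 1) ≤ (F.L : ℝ) ^ 4 * a₀ := mul_le_mul_of_nonneg_left hEa (by positivity)
  have hY5 : (F.L : ℝ) ^ 5 * ε (j - 1) ≤ (F.L : ℝ) ^ 5 * a₀ := mul_le_mul_of_nonneg_left hEa (by positivity)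
  have h45 : (F.L : ℝ) ^ 4 * ε (j - 1) ≤ (F.L : ℝ) ^ 5 * ε (j - 1) := by
    have : (F.L : ℝ) ^ 4 ≤ (F.L : ℝ) ^ 5 := pow_le_pow_right₀ hL1 (by norm_num)
    exact mul_le_mul_of_nonneg_right this hE0.le
  have ha₀ : 0 ≤ a₀ := hE0.le.trans hEa
  have hZ4 : 0 ≤ (F.L : ℝ) ^ 4 * a₀ := by positivity
  have hZ5 : 0 ≤ (F.L : ℝ) ^ 5 * a₀ := by positivity
  have hCrZ : 0 ≤ Cr * ((F.L : ℝ) ^ 5 * a₀) := by positivity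
  have hCωZ : 0 ≤ Cω * ((F.L : ℝ) ^ 5 * a₀) := by positivity
  -- ### ✓p758613's four rows and MODULE 138's three (via MODULE 139's monomials)
  have hB1 : 12800 * ((((F.P K).d : ℝ) + 2) ^ 2 * (((F.P K).d - 1 : ℕ) : ℝ) * ((F.P K).L : ℝ) ^ (2 * j + 2) * (ε (j - 1) * (F.P K).eta (j - 1) ^ 2)) ≤ 1 := by
    simp only [hdN, hLN, hη, Nat.cast_ofNat]
    linarith only [key, hY4, h11]
  have hB2 : 60 * ((((F.P K).d : ℝ) + 2) ^ 2 * (((F.P K).d - 1 : ℕ) : ℝ) * ((F.P K).L : ℝ) ^ (2 * j + 2) * (ε (j - 1) * (F.P K).eta (j - 1) ^ 2)) < deltaSU (Fin N) := by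
    simp only [hdN, hLN, hη, Nat.cast_ofNat]
    linarith only [key, hY4, h12, hZ4]
  have hB3 : 960 * (((F.P K).d : ℝ) * (((F.P K).d : ℝ) + 2) ^ 3 * (((F.P K).d - 1 : ℕ) : ℝ) * ((F.P K).L : ℝ) ^ (2 * j + 3) * (ε (j - 1) * (F.P K).eta (j - 1) ^ 2)) < deltaSU (Fin N) := by
    simp only [hdN, hLN, hη, Nat.cast_ofNat]
    linarith only [key3, hY5, h15, hCrZ, hCωZ, hZ5]
  have hX1 : 0 ≤ (((F.P K).d : ℝ) + 2) ^ 2 * (((F.P K).d - 1 : ℕ) : ℝ) * ((F.P K).L : ℝ) ^ (2 * j + 2) * (ε (j - 1) * (F.P K).eta (j - 1) ^ 2) := by positivity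
  have r1 : 48000 * (((F.P K).d : ℝ) * (((F.P K).d : ℝ) + 2) * (((F.P K).d - 1 : ℕ) : ℝ) ^ 2 * ((F.P K).L : ℝ) ^ (2 * j + 2) * (ε (j - 1) * (F.P K).eta (j - 1) ^ 2)) ≤ 1 := by
    simp only [hdN, hLN, hη, Nat.cast_ofNat]
    linarith only [key, hY4, h11, hZ4]
  have r2 : 480 * (((F.P K).d : ℝ) * (((F.P K).d : ℝ) + 2) * (((F.P K).d - 1 : ℕ) : ℝ) ^ 2 * ((F.P K).L : ℝ) ^ (2 * j + 2) * (ε (j - 1) * (F.P K).eta (j - 1) ^ 2)) < (FederbushMean.federbushSU (n := Fin N)).δ := by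
    simp only [hdN, hLN, hη, Nat.cast_ofNat]
    linarith only [key, hY4, h2, hZ4]
  have r3 : 6400 * ((((F.P K).d : ℝ) + 2) ^ 2 * (((F.P K).d - 1 : ℕ) : ℝ) * ((F.P K).L : ℝ) ^ (2 * j + 2) * (ε (j - 1) * (F.P K).eta (j - 1) ^ 2)) ≤ 1 := by linarith only [hB1, hX1]
  have r4 : 30 * ((((F.P K).d : ℝ) + 2) ^ 2 * (((F.P K).d - 1 : ℕ) : ℝ) * ((F.P K).L : ℝ) ^ (2 * j + 2) * (ε (j - 1) * (F.P K).eta (j - 1) ^ 2)) < deltaSU (Fin N) := by linarith only [hB2, hX1]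
  have r5 : (∀ i, i < j → 6400 * ((((F.P K).d + 2) * (F.P K).L : ℕ) : ℝ) ^ 2 * ((F.P K).L : ℝ) ^ (i + 1) * (((((F.P K).d - 1 : ℕ) : ℝ)) * (((2 * (F.P K).L ^ (i + 1) - 1 : ℕ) : ℝ)) * (ε (j - 1) * (F.P K).eta (j - 1) ^ 2)) ≤ 1) :=
    fun i hi => (twoBlock_bud_le (P := F.P K) (Nat.succ_le_of_lt hi) hEη0).trans hB1
  have r6 : (∀ i, i < j → 30 * ((((F.P K).d + 2) * (F.P K).L : ℕ) : ℝ) ^ 2 * ((F.P K).L : ℝ) ^ (i + 1) * (((((F.P K).d - 1 : ℕ) : ℝ)) * (((2 * (F.P K).L ^ (i + 1) - 1 : ℕ) : ℝ)) * (ε (j - 1) * (F.P K).eta (j - 1) ^ 2)) < deltaSU (Fin N)) :=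
    fun i hi => lt_of_le_of_lt (twoBlock_gd_le (P := F.P K) (Nat.succ_le_of_lt hi) hEη0) hB2
  have r7 : (∀ i, i < j → (((((F.P K).d + 2) * (F.P K).L : ℕ) : ℝ) ^ 2 / 4) * ((4 * (((((F.P K).d - 1 : ℕ) : ℝ)) * ((2 * (F.P K).L - 1 : ℕ) : ℝ)) + 1) * (240 * ((((F.P K).d + 2) * (F.P K).L : ℕ) : ℝ) * ((F.P K).L : ℝ) ^ i * (((((F.P K).d - 1 : ℕ) : ℝ)) * (((2 * (F.P K).L ^ (i + 1) - 1 : ℕ) : ℝ)) * (ε (j - 1) * (F.P K).eta (j - 1) ^ 2)))) < deltaSU (Fin N)) :=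
    fun i hi => lt_of_le_of_lt (twoBlock_sm_le (P := F.P K) hd1 (Nat.succ_le_of_lt hi) hEη0) hB3
  -- ### INTENT-33's three rows at `α₀ = L³ε_{j−1}`
  have hE5a : ((F.L : ℝ) ^ 3 * ε (j - 1)) * (F.L : ℝ) ^ 2 ≤ (F.L : ℝ) ^ 5 * a₀ := by
    calc ((F.L : ℝ) ^ 3 * ε (j - 1)) * (F.L : ℝ) ^ 2 = (F.L : ℝ) ^ 5 * ε (j - 1) := by ring
      _ ≤ (F.L : ℝ) ^ 5 * a₀ := hY5
  have hE5b : (F.L : ℝ) ^ 2 * ((F.L : ℝ) ^ 3 * ε (j - 1)) ≤ (F.L : ℝ) ^ 5 * a₀ := by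
    calc (F.L : ℝ) ^ 2 * ((F.L : ℝ) ^ 3 * ε (j - 1)) = (F.L : ℝ) ^ 5 * ε (j - 1) := by ring
      _ ≤ (F.L : ℝ) ^ 5 * a₀ := hY5
  have r8 : C0Z (F.P K).d * ((((F.P K).L : ℝ) ^ 3 * ε (j - 1)) * ((F.P K).L : ℝ) ^ 2) ≤ 1 / 3 := by
    have hC : C0Z 4 = 26419200 := by norm_num [C0Z]
    simp only [hdN, hLN, hC]
    linarith only [hE5a, h13, hCrZ, hCωZ]
  have r9 : 2 * ((((F.P K).L : ℝ) ^ 3 * ε (j - 1)) * ((F.P K).L : ℝ) ^ 2) ≤ c2' (F.P K).d (F.P K).L := by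
    simp only [hdN, hLN]
    linarith only [hE5a, h9]
  have r10 : 11 * ((F.P K).d : ℝ) ^ 2 * ((F.P K).L : ℝ) ^ 2 * (((F.P K).L : ℝ) ^ 3 * ε (j - 1)) ≤ 1 / 6 := by
    simp only [hdN, hLN, Nat.cast_ofNat]
    linarith only [hE5b, h13, hCrZ, hCωZ]
  -- ### the `ω_τ` rows
  have r11 : (3840 * (((F.P K).d : ℝ) * (((F.P K).d : ℝ) + 2) * (((F.P K).d - 1 : ℕ) : ℝ) ^ 2 * ((F.P K).L : ℝ) ^ (2 * j + 2) * (ε (j - 1) * (F.P K).eta (j - 1) ^ 2))) ≤ 1 / 128 := by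
    simp only [hdN, hLN, hη, Nat.cast_ofNat]
    linarith only [key, hY4, h11]
  have r12 : 4 * (3840 * (((F.P K).d : ℝ) * (((F.P K).d : ℝ) + 2) * (((F.P K).d - 1 : ℕ) : ℝ) ^ 2 * ((F.P K).L : ℝ) ^ (2 * j + 2) * (ε (j - 1) * (F.P K).eta (j - 1) ^ 2))) < deltaSU (Fin N) := by
    simp only [hdN, hLN, hη, Nat.cast_ofNat]
    linarith only [key, hY4, h12, hZ4]
  have r16 : 18 * (3840 * (((F.P K).d : ℝ) * (((F.P K).d : ℝ) + 2) * (((F.P K).d - 1 : ℕ) : ℝ) ^ 2 * ((F.P K).L : ℝ) ^ (2 * j + 2) * (ε (j - 1) * (F.P K).eta (j - 1) ^ 2))) ≤ ω₁ := by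
    simp only [hdN, hLN, hη, Nat.cast_ofNat]
    linarith only [key, hY4, h16, hZ4]
  -- ### `ω_τ + ω_u ≤ (830352 + 4Cr + 59719680Cω)·L⁵·ε_{j−1}` (`s = ⌊(L−1)∕2⌋ ≤ L∕2`)
  have hs0 : (0 : ℝ) ≤ (((F.L - 1) / 2 : ℕ) : ℝ) := Nat.cast_nonneg _
  have hsL : (((F.L - 1) / 2 : ℕ) : ℝ) ≤ (F.L : ℝ) / 2 := by
    have h : 2 * ((F.L - 1) / 2) ≤ F.L := (Nat.mul_div_le (F.L - 1) 2).trans (Nat.sub_le _ _)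
    have h' : (2 : ℝ) * (((F.L - 1) / 2 : ℕ) : ℝ) ≤ F.L := by exact_mod_cast h
    linarith
  have f1 : (((F.L - 1) / 2 : ℕ) : ℝ) * ((F.L : ℝ) ^ 3 * ε (j - 1)) ≤ (F.L : ℝ) / 2 * ((F.L : ℝ) ^ 3 * ε (j - 1)) :=
    mul_le_mul_of_nonneg_right hsL (by positivity)
  have f2 : (((F.L - 1) / 2 : ℕ) : ℝ) * ((((F.L - 1) / 2 : ℕ) : ℝ) * ((F.L : ℝ) ^ 3 * ε (j - 1))) ≤ (F.L : ℝ) / 2 * ((F.L : ℝ) / 2 * ((F.L : ℝ) ^ 3 * ε (j - 1))) :=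
    mul_le_mul hsL f1 (by positivity) (by positivity)
  have f3 : (((F.L - 1) / 2 : ℕ) : ℝ) * (Cr * ((F.L : ℝ) ^ 3 * ε (j - 1))) ≤ (F.L : ℝ) / 2 * (Cr * ((F.L : ℝ) ^ 3 * ε (j - 1))) :=
    mul_le_mul_of_nonneg_right hsL (by positivity)
  have f4 : (((F.L - 1) / 2 : ℕ) : ℝ) * (Cω * ((F.L : ℝ) ^ (2 * j + 2) * (ε (j - 1) * (((F.L : ℝ) ^ (j - 1))⁻¹) ^ 2))) ≤
      (F.L : ℝ) / 2 * (Cω * ((F.L : ℝ) ^ (2 * j + 2) * (ε (j - 1) * (((F.L : ℝ) ^ (j - 1))⁻¹) ^ 2))) :=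
    mul_le_mul_of_nonneg_right hsL (by positivity)
  have kX : (F.L : ℝ) / 2 * (Cω * ((F.L : ℝ) ^ (2 * j + 2) * (ε (j - 1) * (((F.L : ℝ) ^ (j - 1))⁻¹) ^ 2))) = Cω * ((F.L : ℝ) ^ 5 * ε (j - 1)) / 2 := by
    rw [key]; ring
  have kΩ : Cω * ((F.L : ℝ) ^ (2 * j + 2) * (ε (j - 1) * (((F.L : ℝ) ^ (j - 1))⁻¹) ^ 2)) = Cω * ((F.L : ℝ) ^ 4 * ε (j - 1)) := by rw [key]
  have f6 : Cr * ((F.L : ℝ) ^ 4 * ε (j - 1)) ≤ Cr * ((F.L : ℝ) ^ 5 * ε (j - 1)) := mul_le_mul_of_nonneg_left h45 hCr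
  have f7 : Cr * ((F.L : ℝ) ^ 3 * ε (j - 1)) ≤ Cr * ((F.L : ℝ) ^ 4 * ε (j - 1)) := by
    have : (F.L : ℝ) ^ 3 ≤ (F.L : ℝ) ^ 4 := pow_le_pow_right₀ hL1 (by norm_num)
    exact mul_le_mul_of_nonneg_left (mul_le_mul_of_nonneg_right this hE0.le) hCr
  have hS : (3840 * (((F.P K).d : ℝ) * (((F.P K).d : ℝ) + 2) * (((F.P K).d - 1 : ℕ) : ℝ) ^ 2 * ((F.P K).L : ℝ) ^ (2 * j + 2) * (ε (j - 1) * (F.P K).eta (j - 1) ^ 2))) + (3 * ((F.P K).d : ℝ) * ((((F.P K).L - 1) / 2 : ℕ) : ℝ) * ((9 * ((F.P K).d : ℝ) ^ 2 + 4 * ((F.P K).d : ℝ) * ((((F.P K).L - 1) / 2 : ℕ) : ℝ)) * (((F.P K).L : ℝ) ^ 3 * ε (j - 1))) + 2 * ((F.P K).d : ℝ) * ((((F.P K).L - 1) / 2 : ℕ) : ℝ) * (Cr * (((F.P K).L : ℝ) ^ 3 * ε (j - 1)) + Cω * (18 * (3840 * (((F.P K).d : ℝ) * (((F.P K).d : ℝ)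 + 2) * (((F.P K).d - 1 : ℕ) : ℝ) ^ 2 * ((F.P K).L : ℝ) ^ (2 * j + 2) * (ε (j - 1) * (F.P K).eta (j - 1) ^ 2)))))) ≤
      (830352 + 4 * Cr + 59719680 * Cω) * (F.L : ℝ) ^ 5 * ε (j - 1) := by
    simp only [hdN, hLN, hη, Nat.cast_ofNat]
    linarith only [key, f1, f2, f3, f4, kX, f6, h45]
  have hS0 : 0 ≤ (3840 * (((F.P K).d : ℝ) * (((F.P K).d : ℝ) + 2) * (((F.P K).d - 1 : ℕ) : ℝ) ^ 2 * ((F.P K).L : ℝ) ^ (2 * j + 2) * (ε (j - 1) * (F.P K).eta (j - 1) ^ 2))) + (3 * ((F.P K).d : ℝ) * ((((F.P K).L - 1) / 2 : ℕ) : ℝ) * ((9 * ((F.P K).d : ℝ) ^ 2 + 4 * ((F.P K).d : ℝ) * ((((F.P K).L - 1) / 2 : ℕ) : ℝ)) * (((F.P K).L : ℝ) ^ 3 * ε (j - 1))) + 2 * ((F.P K).d : ℝ) * ((((F.P K).L - 1) / 2 : ℕ) : ℝ) * (Cr * (((F.P K).L : ℝ) ^ 3 * ε (j - 1)) + Cω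 * (18 * (3840 * (((F.P K).d : ℝ) * (((F.P K).d : ℝ) + 2) * (((F.P K).d - 1 : ℕ) : ℝ) ^ 2 * ((F.P K).L : ℝ) ^ (2 * j + 2) * (ε (j - 1) * (F.P K).eta (j - 1) ^ 2)))))) := by positivity
  have hW0 : 0 ≤ (830352 + 4 * Cr + 59719680 * Cω) * (F.L : ℝ) ^ 5 := by positivity
  have hSa : (3840 * (((F.P K).d : ℝ) * (((F.P K).d : ℝ) + 2) * (((F.P K).d - 1 : ℕ) : ℝ) ^ 2 * ((F.P K).L : ℝ) ^ (2 * j + 2) * (ε (j - 1) * (F.P K).eta (j - 1) ^ 2))) + (3 * ((F.P K).d : ℝ) * ((((F.P K).L - 1) / 2 : ℕ) : ℝ) * ((9 * ((F.P K).d : ℝ) ^ 2 + 4 * ((F.P K).d : ℝ) * ((((F.P K).L - 1) / 2 : ℕ) : ℝ)) * (((F.P K).L : ℝ) ^ 3 * ε (j - 1))) + 2 * ((F.P K).d : ℝ) * ((((F.P K).L - 1) / 2 : ℕ) : ℝ) * (Cr * (((F.P K).L : ℝ) ^ 3 * ε (j - 1)) + Cω * (18 * (3840 * (((F.P K).d :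 ℝ) * (((F.P K).d : ℝ) + 2) * (((F.P K).d - 1 : ℕ) : ℝ) ^ 2 * ((F.P K).L : ℝ) ^ (2 * j + 2) * (ε (j - 1) * (F.P K).eta (j - 1) ^ 2)))))) ≤ (830352 + 4 * Cr + 59719680 * Cω) * (F.L : ℝ) ^ 5 * a₀ :=
    hS.trans (mul_le_mul_of_nonneg_left hEa hW0)
  have hSj : (3840 * (((F.P K).d : ℝ) * (((F.P K).d : ℝ) + 2) * (((F.P K).d - 1 : ℕ) : ℝ) ^ 2 * ((F.P K).L : ℝ) ^ (2 * j + 2) * (ε (j - 1) * (F.P K).eta (j - 1) ^ 2))) + (3 * ((F.P K).d : ℝ) * ((((F.P K).L - 1) / 2 : ℕ) : ℝ) * ((9 * ((F.P K).d : ℝ) ^ 2 + 4 * ((F.P K).d : ℝ) * ((((F.P K).L - 1) / 2 : ℕ) : ℝ)) * (((F.P K).L : ℝ) ^ 3 * ε (j - 1))) + 2 * ((F.P K).d : ℝ) * ((((F.P K).L - 1) / 2 : ℕ) : ℝ) * (Cr * (((F.P K).L : ℝ) ^ 3 * ε (j - 1)) + Cω * (18 * (3840 * (((F.P K).d : ℝ)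 * (((F.P K).d : ℝ) + 2) * (((F.P K).d - 1 : ℕ) : ℝ) ^ 2 * ((F.P K).L : ℝ) ^ (2 * j + 2) * (ε (j - 1) * (F.P K).eta (j - 1) ^ 2)))))) ≤ (830352 + 4 * Cr + 59719680 * Cω) * (F.L : ℝ) ^ 5 * (2 * ε j) :=
    hS.trans (mul_le_mul_of_nonneg_left hE2 hW0)
  have r13 : (3840 * (((F.P K).d : ℝ) * (((F.P K).d : ℝ) + 2) * (((F.P K).d - 1 : ℕ) : ℝ) ^ 2 * ((F.P K).L : ℝ) ^ (2 * j + 2) * (ε (j - 1) * (F.P K).eta (j - 1) ^ 2))) + (3 * ((F.P K).d : ℝ) * ((((F.P K).L - 1) / 2 : ℕ) : ℝ) * ((9 * ((F.P K).d : ℝ) ^ 2 + 4 * ((F.P K).d : ℝ) * ((((F.P K).L - 1) / 2 : ℕ) : ℝ)) * (((F.P K).L : ℝ) ^ 3 * ε (j - 1))) + 2 * ((F.P K).d : ℝ) * ((((F.P K).L - 1) / 2 : ℕ) : ℝ) * (Cr * (((F.P K).L : ℝ) ^ 3 * ε (j - 1)) + Cω * (18 * (3840 * (((F.P K).d : ℝ)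 * (((F.P K).d : ℝ) + 2) * (((F.P K).d - 1 : ℕ) : ℝ) ^ 2 * ((F.P K).L : ℝ) ^ (2 * j + 2) * (ε (j - 1) * (F.P K).eta (j - 1) ^ 2)))))) ≤ 1 / 512 := hSa.trans h13
  have hθ : ((F.P K).L : ℝ)⁻¹ ≤ 1 / 8 := inv_L_le_eighth (eight_le_L_record F K)
  have r14 : 4096 * ((F.P K).L : ℝ)⁻¹ * ((3840 * (((F.P K).d : ℝ) * (((F.P K).d : ℝ) + 2) * (((F.P K).d - 1 : ℕ) : ℝ) ^ 2 * ((F.P K).L : ℝ) ^ (2 * j + 2) * (ε (j - 1) * (F.P K).eta (j - 1) ^ 2))) + (3 * ((F.P K).d : ℝ) * ((((F.P K).L - 1) / 2 : ℕ) : ℝ) * ((9 * ((F.P K).d : ℝ) ^ 2 + 4 * ((F.P K).d : ℝ) * ((((F.P K).L - 1) / 2 : ℕ) : ℝ)) * (((F.P K).L : ℝ) ^ 3 * ε (j - 1))) + 2 * ((F.P K).d : ℝ) * ((((F.P K).L - 1) / 2 : ℕ) : ℝ) * (Cr * (((F.P K).L : ℝ) ^ 3 * ε (j - 1)) + Cω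 * (18 * (3840 * (((F.P K).d : ℝ) * (((F.P K).d : ℝ) + 2) * (((F.P K).d - 1 : ℕ) : ℝ) ^ 2 * ((F.P K).L : ℝ) ^ (2 * j + 2) * (ε (j - 1) * (F.P K).eta (j - 1) ^ 2))))))) ≤ 1 := by
    calc 4096 * ((F.P K).L : ℝ)⁻¹ * ((3840 * (((F.P K).d : ℝ) * (((F.P K).d : ℝ) + 2) * (((F.P K).d - 1 : ℕ) : ℝ) ^ 2 * ((F.P K).L : ℝ) ^ (2 * j + 2) * (ε (j - 1) * (F.P K).eta (j - 1) ^ 2))) + (3 * ((F.P K).d : ℝ) * ((((F.P K).L - 1) / 2 : ℕ) : ℝ) * ((9 * ((F.P K).d : ℝ) ^ 2 + 4 * ((F.P K).d : ℝ) * ((((F.P K).L - 1) / 2 : ℕ) : ℝ)) * (((F.P K).L : ℝ) ^ 3 * ε (j - 1))) + 2 * ((F.P K).d : ℝ) * ((((F.P K).L - 1) / 2 : ℕ) : ℝ) * (Cr * (((F.P K).L : ℝ) ^ 3 * ε (j - 1)) + Cω * (18 * (3840 * (((F.P K).d : ℝ) * (((F.P K).d : ℝ) + 2) * (((F.P K).d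 - 1 : ℕ) : ℝ) ^ 2 * ((F.P K).L : ℝ) ^ (2 * j + 2) * (ε (j - 1) * (F.P K).eta (j - 1) ^ 2)))))))
        ≤ 4096 * (1 / 8) * (1 / 512) := mul_le_mul (mul_le_mul_of_nonneg_left hθ (by norm_num)) r13 hS0 (by norm_num)
      _ = 1 := by norm_num
  have r15 : 4 * ((3840 * (((F.P K).d : ℝ) * (((F.P K).d : ℝ) + 2) * (((F.P K).d - 1 : ℕ) : ℝ) ^ 2 * ((F.P K).L : ℝ) ^ (2 * j + 2) * (ε (j - 1) * (F.P K).eta (j - 1) ^ 2))) + (3 * ((F.P K).d : ℝ) * ((((F.P K).L - 1) / 2 : ℕ) : ℝ) * ((9 * ((F.P K).d : ℝ) ^ 2 + 4 * ((F.P K).d : ℝ) * ((((F.P K).L - 1) / 2 : ℕ) : ℝ)) * (((F.P K).L : ℝ) ^ 3 * ε (j - 1))) + 2 * ((F.P K).d : ℝ) * ((((F.P K).L - 1) / 2 : ℕ) : ℝ) * (Cr * (((F.P K).L : ℝ) ^ 3 * ε (j - 1)) + Cω * (18 * (3840 * (((F.P K).d : ℝ) * (((F.P K).d : ℝ) + 2)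 * (((F.P K).d - 1 : ℕ) : ℝ) ^ 2 * ((F.P K).L : ℝ) ^ (2 * j + 2) * (ε (j - 1) * (F.P K).eta (j - 1) ^ 2))))))) + 32768 * ((3840 * (((F.P K).d : ℝ) * (((F.P K).d : ℝ) + 2) * (((F.P K).d - 1 : ℕ) : ℝ) ^ 2 * ((F.P K).L : ℝ) ^ (2 * j + 2) * (ε (j - 1) * (F.P K).eta (j - 1) ^ 2))) + (3 * ((F.P K).d : ℝ) * ((((F.P K).L - 1) / 2 : ℕ) : ℝ) * ((9 * ((F.P K).d : ℝ) ^ 2 + 4 * ((F.P K).d : ℝ) * ((((F.P K).L - 1) / 2 : ℕ) : ℝ)) * (((F.P K).L : ℝ) ^ 3 * ε (j - 1))) + 2 * ((F.P K).d : ℝ) * ((((F.P K).L - 1) / 2 : ℕ) : ℝ) * (Cr * (((F.P K).L : ℝ) ^ 3 * ε (j - 1)) + Cω * (18 * (3840 * (((F.P K).d : ℝ) * (((F.P K).d : ℝ) + 2) * (((F.P K).d - 1 : ℕ) : ℝ) ^ 2 * ((F.P K).L : ℝ) ^ (2 * j + 2) * (ε (j - 1) * (F.P K).eta (j - 1) ^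 2))))))) ^ 2 < deltaSU (Fin N) := by
    set S : ℝ := (3840 * (((F.P K).d : ℝ) * (((F.P K).d : ℝ) + 2) * (((F.P K).d - 1 : ℕ) : ℝ) ^ 2 * ((F.P K).L : ℝ) ^ (2 * j + 2) * (ε (j - 1) * (F.P K).eta (j - 1) ^ 2))) + (3 * ((F.P K).d : ℝ) * ((((F.P K).L - 1) / 2 : ℕ) : ℝ) * ((9 * ((F.P K).d : ℝ) ^ 2 + 4 * ((F.P K).d : ℝ) * ((((F.P K).L - 1) / 2 : ℕ) : ℝ)) * (((F.P K).L : ℝ) ^ 3 * ε (j - 1))) + 2 * ((F.P K).d : ℝ) * ((((F.P K).L - 1) / 2 : ℕ) : ℝ) * (Cr * (((F.P K).L : ℝ) ^ 3 * ε (j - 1)) + Cω * (18 * (3840 * (((F.P K).d : ℝ) * (((F.P K).d : ℝ) + 2) * (((F.P K).d - 1 : ℕ) : ℝ) ^ 2 * ((F.P K).L : ℝ) ^ (2 * j + 2) * (ε (j - 1) * (F.P K).eta (j - 1) ^ 2)))))) with hSdef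
    have hsq : 32768 * S ^ 2 ≤ 64 * S := by nlinarith only [hS0, r13]
    linarith only [hSa, h15, hsq, hS0]
  -- ### the door budget and `4Nr < 2π`: `r ≤ (Cr + 14929920Cω)·L⁴·ε_{j−1}`
  have hr : Cr * (((F.P K).L : ℝ) ^ 3 * ε (j - 1)) + Cω * (18 * (3840 * (((F.P K).d : ℝ) * (((F.P K).d : ℝ) + 2) * (((F.P K).d - 1 : ℕ) : ℝ) ^ 2 * ((F.P K).L : ℝ) ^ (2 * j + 2) * (ε (j - 1) * (F.P K).eta (j - 1) ^ 2)))) ≤ (Cr + 14929920 * Cω) * (F.L : ℝ) ^ 4 * ε (j - 1) := by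
    simp only [hdN, hLN, hη, Nat.cast_ofNat]
    linarith only [kΩ, f7]
  have hR0 : 0 ≤ (Cr + 14929920 * Cω) * (F.L : ℝ) ^ 4 := by positivity
  have r17 : 2 * ((Cr * (((F.P K).L : ℝ) ^ 3 * ε (j - 1)) + Cω * (18 * (3840 * (((F.P K).d : ℝ) * (((F.P K).d : ℝ) + 2) * (((F.P K).d - 1 : ℕ) : ℝ) ^ 2 * ((F.P K).L : ℝ) ^ (2 * j + 2) * (ε (j - 1) * (F.P K).eta (j - 1) ^ 2))))) * ((F.P K).L : ℝ) ^ 4) < κ * ε j := by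
    have hL4 : ((F.P K).L : ℝ) ^ 4 = (F.L : ℝ) ^ 4 := by rw [hLN]
    have u2 : 2 * ((Cr * (((F.P K).L : ℝ) ^ 3 * ε (j - 1)) + Cω * (18 * (3840 * (((F.P K).d : ℝ) * (((F.P K).d : ℝ) + 2) * (((F.P K).d - 1 : ℕ) : ℝ) ^ 2 * ((F.P K).L : ℝ) ^ (2 * j + 2) * (ε (j - 1) * (F.P K).eta (j - 1) ^ 2))))) * ((F.P K).L : ℝ) ^ 4) ≤ 2 * (((Cr + 14929920 * Cω) * (F.L : ℝ) ^ 4 * (2 * ε j)) * (F.L : ℝ) ^ 4) := by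
      rw [hL4]
      exact mul_le_mul_of_nonneg_left (mul_le_mul_of_nonneg_right (hr.trans (mul_le_mul_of_nonneg_left hE2 hR0)) (by positivity)) (by norm_num)
    have u3 : 2 * (((Cr + 14929920 * Cω) * (F.L : ℝ) ^ 4 * (2 * ε j)) * (F.L : ℝ) ^ 4) = (4 * (Cr + 14929920 * Cω) * (F.L : ℝ) ^ 8) * ε j := by ring
    have u4 : (4 * (Cr + 14929920 * Cω) * (F.L : ℝ) ^ 8) * ε j < κ * ε j := mul_lt_mul_of_pos_right hκ hεj0
    linarith only [u2, u3, u4]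
  have r18 : 4 * ((N : ℝ) * (Cr * (((F.P K).L : ℝ) ^ 3 * ε (j - 1)) + Cω * (18 * (3840 * (((F.P K).d : ℝ) * (((F.P K).d : ℝ) + 2) * (((F.P K).d - 1 : ℕ) : ℝ) ^ 2 * ((F.P K).L : ℝ) ^ (2 * j + 2) * (ε (j - 1) * (F.P K).eta (j - 1) ^ 2)))))) < 2 * Real.pi := by
    have u2 : (N : ℝ) * (Cr * (((F.P K).L : ℝ) ^ 3 * ε (j - 1)) + Cω * (18 * (3840 * (((F.P K).d : ℝ) * (((F.P K).d : ℝ) + 2) * (((F.P K).d - 1 : ℕ) : ℝ) ^ 2 * ((F.P K).L : ℝ) ^ (2 * j + 2) * (ε (j - 1) * (F.P K).eta (j - 1) ^ 2))))) ≤ (N : ℝ) * ((Cr + 14929920 * Cω) * (F.L : ℝ) ^ 4 * a₀) :=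
      mul_le_mul_of_nonneg_left (hr.trans (mul_le_mul_of_nonneg_left hEa hR0)) (Nat.cast_nonneg N)
    linarith only [u2, h18]
  -- ### row 9′'s size at `Ψ ε j := ψc·(κ·ε j)²`
  have r19 : 1024 * (4 * ((3840 * (((F.P K).d : ℝ) * (((F.P K).d : ℝ) + 2) * (((F.P K).d - 1 : ℕ) : ℝ) ^ 2 * ((F.P K).L : ℝ) ^ (2 * j + 2) * (ε (j - 1) * (F.P K).eta (j - 1) ^ 2))) + (3 * ((F.P K).d : ℝ) * ((((F.P K).L - 1) / 2 : ℕ) : ℝ) * ((9 * ((F.P K).d : ℝ) ^ 2 + 4 * ((F.P K).d : ℝ) * ((((F.P K).L - 1) / 2 : ℕ) : ℝ)) * (((F.P K).L : ℝ) ^ 3 * ε (j - 1))) + 2 * ((F.P K).d : ℝ) * ((((F.P K).L - 1) / 2 : ℕ) : ℝ) * (Cr * (((F.P K).L : ℝ) ^ 3 * ε (j - 1)) + Cω * (18 * (3840 * (((F.P K).d : ℝ) * (((F.P K).d : ℝ) + 2) * (((F.P K).d - 1 : ℕ) : ℝ) ^ 2 * ((F.P K).L : ℝ) ^ (2 * j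 + 2) * (ε (j - 1) * (F.P K).eta (j - 1) ^ 2)))))))) ^ 2 ≤ ψc * (κ * ε j) ^ 2 := by
    set S : ℝ := (3840 * (((F.P K).d : ℝ) * (((F.P K).d : ℝ) + 2) * (((F.P K).d - 1 : ℕ) : ℝ) ^ 2 * ((F.P K).L : ℝ) ^ (2 * j + 2) * (ε (j - 1) * (F.P K).eta (j - 1) ^ 2))) + (3 * ((F.P K).d : ℝ) * ((((F.P K).L - 1) / 2 : ℕ) : ℝ) * ((9 * ((F.P K).d : ℝ) ^ 2 + 4 * ((F.P K).d : ℝ) * ((((F.P K).L - 1) / 2 : ℕ) : ℝ)) * (((F.P K).L : ℝ) ^ 3 * ε (j - 1))) + 2 * ((F.P K).d : ℝ) * ((((F.P K).L - 1) / 2 : ℕ) : ℝ) * (Cr * (((F.P K).L : ℝ) ^ 3 * ε (j - 1)) + Cω * (18 * (3840 * (((F.P K).d : ℝ) * (((F.P K).d : ℝ) + 2) * (((F.P K).d - 1 : ℕ) : ℝ) ^ 2 * ((F.P K).L : ℝ) ^ (2 * j + 2) * (ε (j - 1) * (F.P K).eta (j - 1) ^ 2)))))) with hSdef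
    have h4 : (4 * S) ^ 2 ≤ (4 * ((830352 + 4 * Cr + 59719680 * Cω) * (F.L : ℝ) ^ 5 * (2 * ε j))) ^ 2 :=
      pow_le_pow_left₀ (by positivity) (mul_le_mul_of_nonneg_left hSj (by norm_num)) 2
    calc 1024 * (4 * S) ^ 2
        ≤ 1024 * (4 * ((830352 + 4 * Cr + 59719680 * Cω) * (F.L : ℝ) ^ 5 * (2 * ε j))) ^ 2 := mul_le_mul_of_nonneg_left h4 (by norm_num)
      _ = 65536 * ((830352 + 4 * Cr + 59719680 * Cω) * (F.L : ℝ) ^ 5) ^ 2 * (ε j) ^ 2 := by ring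
      _ ≤ ψc * κ ^ 2 * (ε j) ^ 2 := mul_le_mul_of_nonneg_right hψ (sq_nonneg _)
      _ = ψc * (κ * ε j) ^ 2 := by ring
  exact ⟨r1, r2, r3, r4, r5, r6, r7, r8, r9, r10, r11, r12, r13, r14, r15, r16, r17, r18, r19⟩

/-! ## §2  (v1.1) The eight conditions (and the crown's `L³a₀ ≤ α₁`) are met by every small enough `a₀ > 0` -/

/-- (v1.1) **A FINE LETTER MEETING ALL EIGHT CONDITIONS EXISTS** — for any `Cr, Cω`, `ω₁ > 0`, `α₁ > 0` (the crown's tolerances) and any `N`: some `a₀ > 0` satisfies the eight displayed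
rows of `hnum_of_smallness` AND MODULE 133′'s `L³·a₀ ≤ α₁` (each row is `c·a₀ < b` with `b > 0`: `δ_Fed`, `c2' 4 L`, `1∕128`, `δ_N`, `ω₁`, `1∕512`, `2π`, `α₁`; take `a₀ → 0⁺`).  So the
junction's remaining numeric inputs are the two CHOICES `κ`, `ψc` only. [cite: Balaban1987RG1, (0.4) p.253, (0.11) p.253 (bookkeeping)] -/
theorem exists_fineLetter_small (F : T4Family) (N : ℕ) [NeZero N] (Cr Cω : ℝ) {ω₁ α₁ : ℝ} (hω₁ : 0 < ω₁) (hα₁ : 0 < α₁) :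
    ∃ a₀ : ℝ, 0 < a₀ ∧
      480 * (216 * (F.L : ℝ) ^ 4 * a₀) < (FederbushMean.federbushSU (n := Fin N)).δ ∧
      2 * ((F.L : ℝ) ^ 5 * a₀) ≤ c2' 4 F.L ∧
      3840 * (216 * (F.L : ℝ) ^ 4 * a₀) ≤ 1 / 128 ∧
      4 * (3840 * (216 * (F.L : ℝ) ^ 4 * a₀)) < deltaSU (Fin N) ∧
      18 * (3840 * (216 * (F.L : ℝ) ^ 4 * a₀)) ≤ ω₁ ∧
      (830352 + 4 * Cr + 59719680 * Cω) * (F.L : ℝ) ^ 5 * a₀ ≤ 1 / 512 ∧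
      68 * ((830352 + 4 * Cr + 59719680 * Cω) * (F.L : ℝ) ^ 5 * a₀) < deltaSU (Fin N) ∧
      4 * ((N : ℝ) * ((Cr + 14929920 * Cω) * (F.L : ℝ) ^ 4 * a₀)) < 2 * Real.pi ∧
      (F.L : ℝ) ^ 3 * a₀ ≤ α₁ := by
  -- every row is `c·a₀ < b` with `b > 0`; all hold for `a₀ → 0⁺`
  have ev : ∀ (c : ℝ) {b : ℝ}, 0 < b → ∀ᶠ x in nhdsWithin (0 : ℝ) (Set.Ioi 0), c * x < b := by
    intro c b hb
    have ht : Filter.Tendsto (fun x : ℝ => c * x) (nhds 0) (nhds (c * 0)) := (continuous_const.mul continuous_id).tendsto 0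
    rw [mul_zero] at ht
    exact nhdsWithin_le_nhds (ht.eventually (gt_mem_nhds hb))
  have hFed : 0 < (FederbushMean.federbushSU (n := Fin N)).δ := (FederbushMean.federbushSU (n := Fin N)).δ_pos
  have hδ : 0 < deltaSU (Fin N) := ExpMeanLog.deltaSU_pos
  have hc2 : 0 < c2' 4 F.L := by
    have hL : (0 : ℝ) < F.L := by exact_mod_cast (show 0 < F.L by have := F.hL11; omega)
    unfold c2'; positivity
  have hπ : (0 : ℝ) < 2 * Real.pi := by positivity
  obtain ⟨a₀, ⟨e1, e2, e3, e4, e5, e6, e7, e8, e9⟩, ha₀⟩ :=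
    (((ev (480 * (216 * (F.L : ℝ) ^ 4)) hFed).and <| (ev (2 * (F.L : ℝ) ^ 5) hc2).and <| (ev (3840 * (216 * (F.L : ℝ) ^ 4)) (by norm_num : (0 : ℝ) < 1 / 128)).and <|
      (ev (4 * (3840 * (216 * (F.L : ℝ) ^ 4))) hδ).and <| (ev (18 * (3840 * (216 * (F.L : ℝ) ^ 4))) hω₁).and <|
      (ev ((830352 + 4 * Cr + 59719680 * Cω) * (F.L : ℝ) ^ 5) (by norm_num : (0 : ℝ) < 1 / 512)).and <|
      (ev (68 * ((830352 + 4 * Cr + 59719680 * Cω) * (F.L : ℝ) ^ 5)) hδ).and <| (ev (4 * ((N : ℝ) * ((Cr + 14929920 * Cω) * (F.L : ℝ) ^ 4))) hπ).and <|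
      (ev ((F.L : ℝ) ^ 3) hα₁)).and self_mem_nhdsWithin).exists
  refine ⟨a₀, ha₀, by linarith, by linarith, by linarith, by linarith, by linarith, by linarith, by linarith, by linarith, by linarith⟩

/-! ## §3  (v1.1) The junction's choice of `κ` is linear in `ρ₀` (MODULE 134′'s `κ ≤ Aκ·ρ₀`) -/

/-- (v1.1) **A `κ` MEETING `hnum_of_smallness`'s lower bound AND MODULE 134′'s `κ ≤ Aκ·ρ₀`, UNIFORMLY IN `ρ₀`**: at the pre-composed crown's constants
`Cr := 560·L³·B₀·sideP (F.P 0) Mc (ρ₀·L)`, `Cω := 20·L·B₀` (✓`…N07DatumCrownPhiOfRecordCrownPrecomp.datumCrownPhiAt_of_recordCrownSUPrecompBody`), the lower bound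
`4(Cr + 14929920Cω)L⁸` grows linearly in `ρ₀` (`sideP ≤ Mc + 44 + 2ρ₀L ≤ (Mc + 44 + 2L)·ρ₀`), so `κ := 4(Cr + 14929920Cω)L⁸ + 1 ≤ Aκ·ρ₀` with
`Aκ := 4(560L³B₀(Mc + 44 + 2L) + 14929920·20LB₀)L⁸ + 1`. [cite: Balaban1985RegularSpaces, p.98 («M is a multiple of R₁M₁»); Balaban1987RG1, (0.11) p.253 (bookkeeping)] -/
theorem exists_kappa_choice (F : T4Family) (Mc : ℕ) {B₀ : ℝ} (hB₀ : 0 ≤ B₀) :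
    ∃ Aκ : ℝ, 0 ≤ Aκ ∧ ∀ ρ₀ : ℕ, 1 ≤ ρ₀ →
      ∃ κ : ℝ, 0 < κ ∧ κ ≤ Aκ * (ρ₀ : ℝ) ∧
        4 * ((560 * (F.L : ℝ) ^ 3 * B₀ * (sideP (F.P 0) Mc (ρ₀ * F.L) : ℝ)) + 14929920 * (20 * (F.L : ℝ) * B₀)) * (F.L : ℝ) ^ 8 < κ := by
  refine ⟨4 * ((560 * (F.L : ℝ) ^ 3 * B₀ * ((Mc + 11 * 4 + 2 * F.L : ℕ) : ℝ)) + 14929920 * (20 * (F.L : ℝ) * B₀)) * (F.L : ℝ) ^ 8 + 1, by positivity,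
    fun ρ₀ hρ₀ => ⟨4 * ((560 * (F.L : ℝ) ^ 3 * B₀ * (sideP (F.P 0) Mc (ρ₀ * F.L) : ℝ)) + 14929920 * (20 * (F.L : ℝ) * B₀)) * (F.L : ℝ) ^ 8 + 1,
      by positivity, ?_, by linarith⟩⟩
  have hs : (sideP (F.P 0) Mc (ρ₀ * F.L) : ℝ) ≤ ((Mc + 11 * 4 + 2 * F.L : ℕ) : ℝ) * (ρ₀ : ℝ) := by
    have h1 := sideP_le (P := F.P 0) Mc (ρ₀ * F.L)
    rw [T4Family.P_d] at h1
    have h2 : Mc + 11 * 4 + 2 * (ρ₀ * F.L) ≤ (Mc + 11 * 4 + 2 * F.L) * ρ₀ := by nlinarith [hρ₀]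
    exact_mod_cast h1.trans h2
  have hρ1 : (1 : ℝ) ≤ ρ₀ := by exact_mod_cast hρ₀
  have hK0 : (0 : ℝ) ≤ 560 * (F.L : ℝ) ^ 3 * B₀ * (F.L : ℝ) ^ 8 := by positivity
  have hC0 : (0 : ℝ) ≤ 14929920 * (20 * (F.L : ℝ) * B₀) * (F.L : ℝ) ^ 8 := by positivity
  have p1 := mul_le_mul_of_nonneg_left hs hK0
  have p2 : 14929920 * (20 * (F.L : ℝ) * B₀) * (F.L : ℝ) ^ 8 ≤ 14929920 * (20 * (F.L : ℝ) * B₀) * (F.L : ℝ) ^ 8 * (ρ₀ : ℝ) :=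
    le_mul_of_one_le_right hC0 hρ1
  nlinarith [p1, p2, hρ1]

end Summit.QuantumFields.YangMills.BalabanUVNodes.N07JunctionHnumOfSmallness

end
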